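import Summits.Ventures.LatticeQCDFlow.Exactness.Phi4FlowSamplerSticking
import HarnessLib

/-!
# The exact holding law of flow-MCMC at an atom-free point, and the exact acceptance at a mode of the weight

HONEST FRAMING: exact (Metropolis-corrected) sampling algorithms for lattice gauge theory;
figures of merit are autocorrelation/cost numbers at stated couplings and volumes; no
continuum-physics claim.

Venture `LatticeQCDFlow` (cell pub-lqcd), topic `Exactness`; FANOUT row 30 (lean-1, GEN-28).  NEW WORK of the
cell, general state space.  `Exactness/IMHKernel.lean` (row 30) built the independence Metropolis–Hastings
kernel `K = indepMH q w` (proposal `q`, weight `w = dπ/dq`, acceptance `min{1, w(y)/w(x)}`, acceptance mass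
`A(x)`); `Exactness/Phi4FlowSamplerSticking.lean` (row 2) proved the HOLDING INEQUALITY
`(K^t δ_x)({x}) ≥ (1 − A(x))^t` and `A(x) ≤ Z/w(x)`, `Z = ∫ w dq`.  Here the two EQUALITY cases that make
cold-start statements exact rather than one-sided:

* §1 **`imhAcceptMass_eq_of_forall_le`** — at a MODE of the weight (`w(y) ≤ w(x)` for all `y`) every proposal
  is accepted with probability exactly `w(y)/w(x)`, so `A(x) = Z/w(x)` EXACTLY (`imhAcceptMass_le` is an
  equality there); real form **`imhAcceptMass_toReal_eq_of_forall_le`**;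
* §2 **`indepMH_apply_singleton_eq`** / **`indepMH_apply_singleton_eq_zero`** — if the proposal has no atom at
  `x` (`q{x} = 0`), then `K(x, {x}) = 1 − A(x)` and `K(y, {x}) = 0` for `y ≠ x` (the chain re-enters `x` only
  by rejecting AT `x`); hence (**`bind_indepMH_apply_singleton_eq`**) `(mK)({x}) = (1 − A(x))·m({x})` for every
  initial law `m`, and (**`iterate_bind_indepMH_dirac_singleton_eq`**) THE EXACT GEOMETRIC HOLDING LAW
  `(K^t δ_x)({x}) = (1 − A(x))^t`;
* §3 **`iterate_bind_indepMH_dirac_singleton_real_eq_of_mode`** — both together: started at an atom-free mode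
  `x` of `w`, the flow-MCMC chain is still at `x` after `t` steps with probability EXACTLY `(1 − Z/w(x))^t`;
  the per-step escape probability is exactly `Z/w(x) = (sup-normalised weight)⁻¹`.

Reading (for `Scaling/AutoregressiveGauge…` cold starts, where the cold configuration is the mode of the
importance weight of both the one-plaquette heat-bath and the all-closing conditioner, and the Haar-based
proposals have no atoms): their `≥ (1 − η)^t` freezing bounds are consequences of exact geometric laws whose
rates can be COMPARED between samplers.  NOT CLAIMED: anything away from the mode, or for proposals with atoms
(finite groups).

No `sorry`, nothing cited as a fact; general measurable space with measurable singletons.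
-/

noncomputable section

namespace Summit.Ventures.LatticeQCDFlow.Exactness

open MeasureTheory ProbabilityTheory Function
open scoped ENNReal

variable {Ω : Type*} [MeasurableSpace Ω] [MeasurableSingletonClass Ω]
variable {q : Measure Ω} [IsProbabilityMeasure q] {w : Ω → ℝ}

/-! ## §1 Exact acceptance at a mode of the weight -/

omit [MeasurableSingletonClass Ω] [IsProbabilityMeasure q] in
/-- **At a mode of the weight the acceptance mass is exactly `(∫ w dq)/w(x)`.** [ours] -/
theorem imhAcceptMass_eq_of_forall_le (hw0 : ∀ y, 0 < w y) (x : Ω) (hmax : ∀ y, w y ≤ w x) :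
    imhAcceptMass q w x = ENNReal.ofReal (w x)⁻¹ * ∫⁻ y, ENNReal.ofReal (w y) ∂q := by
  unfold imhAcceptMass
  rw [← lintegral_const_mul' _ _ ENNReal.ofReal_ne_top]
  refine lintegral_congr fun y => ?_
  unfold imhAcceptE imhAccept
  rw [min_eq_right ((div_le_one (hw0 x)).2 (hmax y)), ← ENNReal.ofReal_mul (inv_nonneg.mpr (hw0 x).le),
    div_eq_inv_mul]

omit [MeasurableSingletonClass Ω] [IsProbabilityMeasure q] in
/-- Real form: `A(x) = Z/w(x)` at a mode, `Z = ∫ w dq < ∞`. [ours] -/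
theorem imhAcceptMass_toReal_eq_of_forall_le (hw0 : ∀ y, 0 < w y) (x : Ω) (hmax : ∀ y, w y ≤ w x)
    {Z : ℝ} (hZ0 : 0 ≤ Z) (hZ : ∫⁻ y, ENNReal.ofReal (w y) ∂q = ENNReal.ofReal Z) :
    (imhAcceptMass q w x).toReal = Z / w x := by
  rw [imhAcceptMass_eq_of_forall_le hw0 x hmax, hZ, ← ENNReal.ofReal_mul (inv_nonneg.mpr (hw0 x).le),
    ENNReal.toReal_ofReal (mul_nonneg (inv_nonneg.mpr (hw0 x).le) hZ0), div_eq_inv_mul]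

/-! ## §2 The exact holding law at an atom-free point -/

omit [MeasurableSingletonClass Ω] [IsProbabilityMeasure q] in
/-- The proposal part of the kernel puts no mass on an atom-free point. [ours] -/
theorem setLIntegral_singleton_imhAcceptE_eq_zero {x : Ω} (hqx : q {x} = 0) (y : Ω) :
    ∫⁻ z in {x}, imhAcceptE w y z ∂q = 0 := by
  rw [Measure.restrict_eq_zero.2 hqx, lintegral_zero_measure]

/-- **`K(x, {x}) = 1 − A(x)`** when `q{x} = 0`. [ours] -/
theorem indepMH_apply_singleton_eq (hw : Measurable w) {x : Ω} (hqx : q {x} = 0) :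
    indepMH q w x {x} = 1 - imhAcceptMass q w x := by
  rw [indepMH_apply hw x (measurableSet_singleton x), setLIntegral_singleton_imhAcceptE_eq_zero hqx,
    zero_add, Set.indicator_of_mem (Set.mem_singleton x), Pi.one_apply, mul_one]

/-- **`K(y, {x}) = 0` for `y ≠ x`** when `q{x} = 0`: the chain never jumps INTO an atom-free point. [ours] -/
theorem indepMH_apply_singleton_eq_zero (hw : Measurable w) {x y : Ω} (hyx : y ≠ x) (hqx : q {x} = 0) :
    indepMH q w y {x} = 0 := by
  rw [indepMH_apply hw y (measurableSet_singleton x), setLIntegral_singleton_imhAcceptE_eq_zero hqx,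
    zero_add, Set.indicator_of_notMem (fun h => hyx (Set.mem_singleton_iff.1 h)), mul_zero]

/-- The column `y ↦ K(y, {x})` of the kernel is `(1 − A(x))·𝟙_{x}` when `q{x} = 0`. [ours] -/
theorem indepMH_apply_singleton_eq_indicator (hw : Measurable w) {x : Ω} (hqx : q {x} = 0) (y : Ω) :
    indepMH q w y {x} = ({x} : Set Ω).indicator (fun _ => 1 - imhAcceptMass q w x) y := by
  by_cases hy : y = x
  · subst hy
    rw [indepMH_apply_singleton_eq hw hqx, Set.indicator_of_mem (Set.mem_singleton y)]
  · rw [indepMH_apply_singleton_eq_zero hw hy hqx, Set.indicator_of_notMem (fun h => hy (Set.mem_singleton_iff.1 h))]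

/-- **One step: `(mK)({x}) = (1 − A(x))·m({x})`** for every initial law `m`, when `q{x} = 0`. [ours] -/
theorem bind_indepMH_apply_singleton_eq (hw : Measurable w) {x : Ω} (hqx : q {x} = 0) (m : Measure Ω) :
    (m.bind (indepMH q w)) {x} = (1 - imhAcceptMass q w x) * m {x} := by
  rw [Measure.bind_apply (measurableSet_singleton x) (Kernel.aemeasurable _)]
  simp_rw [indepMH_apply_singleton_eq_indicator hw hqx]
  rw [lintegral_indicator_const (measurableSet_singleton x)]

/-- Iterated, for every initial law: `(mK^t)({x}) = (1 − A(x))^t · m({x})`. [ours] -/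
theorem iterate_bind_indepMH_apply_singleton_eq (hw : Measurable w) {x : Ω} (hqx : q {x} = 0) :
    ∀ (t : ℕ) (m : Measure Ω),
      ((fun ν : Measure Ω => ν.bind (indepMH q w))^[t] m) {x} = (1 - imhAcceptMass q w x) ^ t * m {x}
  | 0, m => by simp
  | t + 1, m => by
    rw [Function.iterate_succ_apply', bind_indepMH_apply_singleton_eq hw hqx,
      iterate_bind_indepMH_apply_singleton_eq hw hqx t m, pow_succ', mul_assoc]

/-- **THE EXACT GEOMETRIC HOLDING LAW.**  `q{x} = 0`; started at `x`, the flow-MCMC chain is still at `x`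
after `t` steps with probability exactly `(1 − A(x))^t`. [ours] -/
theorem iterate_bind_indepMH_dirac_singleton_eq (hw : Measurable w) {x : Ω} (hqx : q {x} = 0) (t : ℕ) :
    ((fun ν : Measure Ω => ν.bind (indepMH q w))^[t] (Measure.dirac x)) {x} = (1 - imhAcceptMass q w x) ^ t := by
  rw [iterate_bind_indepMH_apply_singleton_eq hw hqx t, Measure.dirac_apply_of_mem (Set.mem_singleton x), mul_one]

/-! ## §3 At an atom-free mode: exactly `(1 − Z/w(x))^t` -/

/-- **STARTED AT AN ATOM-FREE MODE OF THE WEIGHT, THE CHAIN IS STILL THERE AFTER `t` STEPS WITH PROBABILITY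
EXACTLY `(1 − Z/w(x))^t`**, `Z = ∫ w dq`; the per-step escape probability is exactly `Z/w(x)`. [ours] -/
theorem iterate_bind_indepMH_dirac_singleton_real_eq_of_mode (hw : Measurable w) (hw0 : ∀ y, 0 < w y)
    {x : Ω} (hqx : q {x} = 0) (hmax : ∀ y, w y ≤ w x) {Z : ℝ} (hZ0 : 0 ≤ Z)
    (hZ : ∫⁻ y, ENNReal.ofReal (w y) ∂q = ENNReal.ofReal Z) (t : ℕ) :
    (((fun ν : Measure Ω => ν.bind (indepMH q w))^[t] (Measure.dirac x)).real {x}) = (1 - Z / w x) ^ t := by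
  have hA1 : imhAcceptMass q w x ≤ 1 := imhAcceptMass_le_one q w x
  rw [Measure.real, iterate_bind_indepMH_dirac_singleton_eq hw hqx t, ENNReal.toReal_pow,
    ENNReal.toReal_sub_of_le hA1 ENNReal.one_ne_top, ENNReal.toReal_one,
    imhAcceptMass_toReal_eq_of_forall_le hw0 x hmax hZ0 hZ]

omit [MeasurableSingletonClass Ω] in
/-- At a mode `Z ≤ w(x)`, i.e. the exact escape probability `Z/w(x)` is at most `1`. [ours] -/
theorem integral_le_of_mode (hw0 : ∀ y, 0 < w y) {x : Ω} (hmax : ∀ y, w y ≤ w x) {Z : ℝ} (hZ0 : 0 ≤ Z)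
    (hZ : ∫⁻ y, ENNReal.ofReal (w y) ∂q = ENNReal.ofReal Z) : Z / w x ≤ 1 := by
  have h := imhAcceptMass_le_one q w x
  have h2 := ENNReal.toReal_mono ENNReal.one_ne_top h
  rw [imhAcceptMass_toReal_eq_of_forall_le hw0 x hmax hZ0 hZ, ENNReal.toReal_one] at h2
  exact h2

end Summit.Ventures.LatticeQCDFlow.Exactness
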